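import Summits.QuantumFields.YangMills.Theorems.BalabanUVNodesN07AveragedPlaquetteCornerBlocks
import Summits.QuantumFields.YangMills.Theorems.BalabanUVNodesN07DataDownTheTowerBlowDown
import Literature.MathematicalPhysics.QuantumFieldTheory.Balaban1983to89.Node00.Record12BgRowTopDomain
import HarnessLib

/-!
# N07 [B11] (= [15] = [Balaban1985Variational]) Sect. F — «NOW WE USE THE ASSUMPTION (7) FOR V» (p. 303) ON THE CHART's TOP BOX, PART 1: THE VERTEX DICHOTOMY AND THE BOND ∕ PLAQUETTE
# VALUES — on the fibre `AgreeOn (genSet Ω k) (M˙U) W`, a level-`j` plaquette of `M^j U` between GOOD vertices IS print's (7) plaquette `(∂V)(p′)`, `V = W_j`, `V̄ = \overline{W_{j−1}}`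
# (the plaquette analysis behind the chart lane's `δ̂`, OUTWARD-MEET-EDITION-SPEC §10 (C1a); generic in `Ω`, `W`, `U`)

Cell `pub-ymgap`, seat `pub-ymgap-dag-n07-e` g24 (FAN-OUT §N07 row s3; LANE OWNER of the K0 road), MODULE 69a part 1 (line budget).  `--kind proof --supports stmt-QuantumFields-20541
--as helper` (K0⁷); count-neutral; def-free.  [15] = [Balaban1985Variational]; [3] = [Balaban1985Averaging]; [III] = [Balaban1988Convergent]; [6] = [Balaban1985RegularSpaces].

THE ITEM (SPEC §10 (C1a); MODULE 62 `…N07NormalisationTopRows` displays `δ̂`).  MODULE 62's top rows need `PlaqSmallOn (boxPlaqs (sqLo_j − 1) (sqHi_j + 1)) δ̂ (M^j U)`: EVERY level-`j`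
plaquette of the `j`-fold average based in the chart's top box (print box + `ρ + 1` blocks) is `δ̂`-small.  On the fibre `M˙(U)|_𝔅 = W` with (7)-small data this holds with `δ̂` δ-LINEAR.  A
GOOD vertex is a level-`j = m+1` label `t` such that (i) NO fine point of its unit box `box L t 1 j` projects into `Ω_{j+1}` (print-margin-clean: the chart box lies in «□̃», MODULE 66 §1),
(ii) for `m ≥ 1` EVERY such point projects into `Ω_m` (the collar of a meeting datum with margin, 57a ∕ `TorusCoverCollarOfMeetsPrintBox` at `E = ρ + 1`); with `Ω_j` a union of level-`j` blocks:
* DICHOTOMY (§2 ★ `corner_dichotomy`): either the vertex `castSite t` lies in `Γ_j^{(j)}` (`Γ_j = Ω_j ∖ Ω_{j+1}` ∕ `Ω_k`), or EVERY level-`m` site under it lies in `Γ_m^{(m)}`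
  (`Γ_m = Ω_m ∖ Ω_{m+1}`, `Γ₀ = Ω₁ᶜ`) — by (i), block saturation and (ii).
* BOND VALUES (§3 ★★ `iter_succ_eq_mixedField_of_corners`): on a level-`j` bond between two such vertices `M^j U = ` print's (7) field `Sect2.mixedField (Γ_j) (W_j) (W_m)`: on a bond of
  `Λ_j` both are `W_j` (the fibre); off `Λ_j` both are the one-step average of a level-`m` configuration and `M^m U = W_m` on the two blocks below (the fibre at level `m`, the dichotomy's
  second branch) — two-block locality of the (0.4) average (`T4ReflectionConeSharp.avgFun_congr₂`).  Hence (§3 ★★ `plaqHol_iter_succ_eq_mixedField`) `M^j U(∂p′) = (7)-field(∂p′)`.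
PART 2 (`…N07ChartTopBoxPlaquettes`): touching plaquettes are printed (7) plaquettes (`< δ_j`); non-touching ones are once-averaged level-`m` data (MODULE 68's tight-hull Prop. 1, `< C_L·δ_m`);
all plaquettes of a box of good labels (MODULE 62's `hV`).

WHAT IS PROVED (sorry-free; no definition; axioms standard; by-name composition + integer box bookkeeping — NOTHING of [15]∕[3]∕[6] analysis).
§1 dictionary: `blockMap_eq_of_mem_unitBox`, `iterBlockOf_cover_of_mem_unitBox` (the level-`j` block point of a fine point of the unit box of `t` is `castSite t`), `embIter_castSite_mem_unitBox`
(the centre of `castSite t` lies in the unit box), `embIter_mem_unitBox_of_blockOf_eq` (so does the centre of every level-`m` site whose block is `castSite t` — MODULE 68's blow-down lemma),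
`mem_Icc_two_of_mem_Icc` (the labels of `[x, x + e_μ + e_ν]` are its four corners), `mem_box_of_mem_unitBox`; §2 ★ `corner_dichotomy`; §3 ★★ `iter_succ_eq_mixedField_of_corners`,
★★ `plaqHol_iter_succ_eq_mixedField`.

HONEST SCOPE.  Count-neutral; the fibre `AgreeOn`, block saturation and the margin∕collar clauses (i)–(ii) are HYPOTHESES (the record instance discharges (i)–(ii) and saturation from
the knit's binders; the fibre stays the token's hypothesis); nothing of Bałaban asserted; `δ̂` ∕ HS3NORM ∕ HCHART-MEET-NORM stay displayed in the knit; K0⁷ ∕ K1⁹ NOT closed; N07 NOT discharged;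
counts unmoved (typed 28∕28 · discharged 5∕27); one finite 𝕋⁴ programme at fixed ε — the route closes the conditional finite-𝕋⁴ rung `BalabanLadder.UV` ONLY; the YM mass gap (Clay) is NOT
proved by any of this; nothing continuum ∕ ℝ⁴ ∕ OS.  No `sorry`, no `def`, no `instance`, no `notation`.

References: [15] (7) p. 278 L20–33, (13) p. 280, (144) p. 300, (147) p. 301, (160) p. 303 («Now we use the assumption (7) for V»); [3] Prop. 1 (51) pp. 25–26; [III] p. 255,
(2.2) p. 255, (2.10)–(2.11) p. 256; [6] p. 98, (1.3)–(1.6) p. 77; [I] = [Balaban1987RG1] (0.1)–(0.4) pp. 251–253.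
-/

set_option autoImplicit false

noncomputable section
open scoped BigOperators Matrix.Norms.L2Operator

namespace Summit.QuantumFields.YangMills.BalabanUVNodes.N07ChartTopBoxPlaquetteValues

open Literature.MathematicalPhysics.QuantumFieldTheory.Balaban1983to89
open Literature.MathematicalPhysics.QuantumFieldTheory.Balaban1983to89.Node00
open Literature.MathematicalPhysics.QuantumFieldTheory.Balaban1983to89.B15DeterminingSets
open T4Continuum (T4Family)
open T4AxialGaugeSmallField (castSite castSite_apply castSite_add_e boxPlaqs)
open B15Eq112TorusCover (cover)
open B14DomainGeom (Pt)
open B7Prop1Explicit (e e_apply)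
open B8Eq131Cubes (box bLo bHi)
open B5Eq118OneStroke (iterBlockOf iterBlockOf_succ)
open GaugeField (plaqHol)
open ExpMeanLog (deltaSU)
open BlockAveraging (blockAvg_avg)
open Literature.MathematicalPhysics.QuantumLattice (blockMap)
open B8Eq17ClassAkV1 (plaqsOf mem_plaqsOf)
open Summit.QuantumFields.YangMills.BalabanUVNodes.N07DataDownTheTowerBlowDown (blockOf_mem_box_of_mem_blowDown ediv_mem_Icc_of_mem_blowDown)
open Summit.QuantumFields.YangMills.BalabanUVNodes.N07AveragedPlaquetteCornerBlocks (castSite_eq_coverAt mem_blowDown_of_blockOf_mem_box corner_mem_box₂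
  dist1_plaqHol_avOfRecord_lt_of_cornerBlocks)
/-! ## §1  Dictionary: the fine unit box `box L t 1 j` of a level-`j` label `t`, its block point, its centre, and the sites below it -/

section Dictionary

variable {P : Params}

/-- `⌊(Lʲ·t + c)∕Lʲ⌋ = t` for `0 ≤ c < Lʲ` (coordinatewise). [folklore] -/
theorem blockMap_eq_of_mem_unitBox {j : ℕ} {t x : Pt P.d} (hx : x ∈ box P.L t 1 j) : blockMap (P.L ^ j) x = t := by
  funext i
  obtain ⟨h1, h2⟩ := hx i
  simp only [bLo, bHi, Nat.cast_zero, sub_zero, add_zero, Nat.cast_one] at h1 h2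
  have hL : (0 : ℤ) < (P.L : ℤ) ^ j := by have := P.L_pos; positivity
  show x i / ((P.L ^ j : ℕ) : ℤ) = t i
  push_cast
  refine le_antisymm ?_ (Int.le_ediv_of_mul_le hL (by linarith))
  have : x i < (t i + 1) * (P.L : ℤ) ^ j := by linarith
  exact Int.lt_add_one_iff.mp ((Int.ediv_lt_iff_lt_mul hL).mpr this)

/-- **THE LEVEL-`j` BLOCK POINT OF A FINE POINT OF THE UNIT BOX OF `t` IS `castSite t`** (standing range). [cite: Balaban1987RG1, (0.1)–(0.3) pp.251–252] -/
theorem iterBlockOf_cover_of_mem_unitBox {j : ℕ} (hj : j ≤ P.m + P.K) {t x : Pt P.d} (hx : x ∈ box P.L t 1 j) :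
    iterBlockOf j (cover P x) = (castSite t : Site P j) := by
  rw [iterBlockOf_cover hj x, blockMap_eq_of_mem_unitBox hx]; rfl

/-- **THE CENTRE OF THE LEVEL-`j` SITE `castSite t` LIES IN THE UNIT BOX OF `t`**: `embIter j (castSite t) = cover (Lʲt + (Lʲ−1)∕2)`. [cite: Balaban1987RG1, (0.1) p.251] -/
theorem embIter_castSite_mem_unitBox {j : ℕ} (hj : j ≤ P.m + P.K) (t : Pt P.d) :
    ∃ x ∈ box P.L t 1 j, embIter j (castSite t : Site P j) = cover P x := by
  refine ⟨fun μ => (P.L : ℤ) ^ j * t μ + ((P.L ^ j - 1) / 2 : ℕ), fun i => ?_, ?_⟩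
  · have hL1 : 1 ≤ P.L ^ j := Nat.one_le_pow _ _ P.L_pos
    have hc : (((P.L ^ j - 1) / 2 : ℕ) : ℤ) ≤ (P.L : ℤ) ^ j - 1 := by
      have : (P.L ^ j - 1) / 2 ≤ P.L ^ j - 1 := Nat.div_le_self _ _
      have h2 : (((P.L ^ j - 1 : ℕ)) : ℤ) = (P.L : ℤ) ^ j - 1 := by push_cast [Nat.cast_sub hL1]; ring
      exact_mod_cast h2 ▸ (by exact_mod_cast this : (((P.L ^ j - 1) / 2 : ℕ) : ℤ) ≤ ((P.L ^ j - 1 : ℕ) : ℤ))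
    simp only [bLo, bHi, Nat.cast_zero, sub_zero, add_zero, Nat.cast_one]
    constructor
    · have : (0 : ℤ) ≤ (((P.L ^ j - 1) / 2 : ℕ) : ℤ) := by positivity
      linarith
    · nlinarith
  · rw [castSite_eq_coverAt, embIter_coverAt hj]

/-- **A LEVEL-`m` SITE WHOSE BLOCK IS `castSite t` HAS ITS CENTRE IN THE UNIT BOX OF `t`** (standing range `m + 1 ≤ P.m + P.K`). [cite: Balaban1987RG1, (0.1)–(0.3) pp.251–252] -/
theorem embIter_mem_unitBox_of_blockOf_eq {m : ℕ} (hm : m + 1 ≤ P.m + P.K) {t : Pt P.d} {y : Site P m} (hy : blockOf y = (castSite t : Site P (m + 1))) :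
    ∃ x ∈ box P.L t 1 (m + 1), embIter m y = cover P x := by
  have hmem : blockOf y ∈ (castSite '' Set.Icc t t : Set (Site P (m + 1))) := ⟨t, ⟨le_rfl, le_rfl⟩, hy.symm⟩
  obtain ⟨s, ⟨hs1, hs2⟩, hsy⟩ := mem_blowDown_of_blockOf_mem_box hm hmem
  refine ⟨fun μ => (P.L : ℤ) ^ m * s μ + ((P.L ^ m - 1) / 2 : ℕ), fun i => ?_, ?_⟩
  · have h1 : (P.L : ℤ) * t i ≤ s i := hs1 i
    have h2 : s i ≤ (P.L : ℤ) * t i + ((P.L : ℤ) - 1) := hs2 i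
    have hL1 : 1 ≤ P.L ^ m := Nat.one_le_pow _ _ P.L_pos
    have hLm : (0 : ℤ) ≤ (P.L : ℤ) ^ m := by positivity
    have hc0 : (0 : ℤ) ≤ (((P.L ^ m - 1) / 2 : ℕ) : ℤ) := by positivity
    have hc : (((P.L ^ m - 1) / 2 : ℕ) : ℤ) ≤ (P.L : ℤ) ^ m - 1 := by
      have : (P.L ^ m - 1) / 2 ≤ P.L ^ m - 1 := Nat.div_le_self _ _
      have h3 : (((P.L ^ m - 1 : ℕ)) : ℤ) = (P.L : ℤ) ^ m - 1 := by push_cast [Nat.cast_sub hL1]; ring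
      exact_mod_cast h3 ▸ (by exact_mod_cast this : (((P.L ^ m - 1) / 2 : ℕ) : ℤ) ≤ ((P.L ^ m - 1 : ℕ) : ℤ))
    simp only [bLo, bHi, Nat.cast_zero, sub_zero, add_zero, Nat.cast_one, pow_succ]
    constructor
    · nlinarith [mul_le_mul_of_nonneg_left h1 hLm]
    · nlinarith [mul_le_mul_of_nonneg_left h2 hLm]
  · rw [← hsy, castSite_eq_coverAt, embIter_coverAt (by omega)]

/-- The integer points of the box `[x, x + e_μ + e_ν]` (`μ ≠ ν`) are its four corners. [folklore] -/
theorem mem_Icc_two_of_mem_Icc {d : ℕ} {x t : Fin d → ℤ} {μ ν : Fin d} (hμν : μ ≠ ν) (ht : t ∈ Set.Icc x (x + e μ + e ν)) :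
    t = x ∨ t = x + e μ ∨ t = x + e ν ∨ t = x + e μ + e ν := by
  obtain ⟨h1, h2⟩ := ht
  have hco : ∀ i, t i = x i ∨ (t i = x i + 1 ∧ (i = μ ∨ i = ν)) := by
    intro i
    have a : x i ≤ t i := h1 i
    have b : t i ≤ (x + e μ + e ν) i := h2 i
    simp only [Pi.add_apply, e_apply] at b
    by_cases hiμ : i = μ
    · subst hiμ; rw [if_pos rfl, if_neg hμν] at b; omega
    · by_cases hiν : i = ν
      · subst hiν; rw [if_neg hiμ, if_pos rfl] at b; omega
      · rw [if_neg hiμ, if_neg hiν] at b; left; omega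
  have key : ∀ i, t i = x i + (if t μ = x μ + 1 then e μ i else 0) + (if t ν = x ν + 1 then e ν i else 0) := by
    intro i
    rcases hco i with h | ⟨h, hi⟩
    · by_cases hiμ : i = μ
      · subst hiμ
        have : ¬ t i = x i + 1 := by omega
        rw [if_neg this]
        split_ifs with h' <;> simp [e_apply, hμν, h]
      · by_cases hiν : i = ν
        · subst hiν
          have : ¬ t i = x i + 1 := by omega
          rw [if_neg this]
          split_ifs with h' <;> simp [e_apply, Ne.symm hμν, h]
        · split_ifs <;> simp [e_apply, hiμ, hiν, h]
    · rcases hi with rfl | rfl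
      · rw [if_pos h]; split_ifs with h' <;> simp [e_apply, hμν, h]
      · rw [if_pos h]
        by_cases h' : t μ = x μ + 1
        · rw [if_pos h']; simp [e_apply, Ne.symm hμν, h]
        · rw [if_neg h']; simp [e_apply, h]
  by_cases hμ : t μ = x μ + 1 <;> by_cases hν : t ν = x ν + 1
  · right; right; right; funext i; rw [key i, if_pos hμ, if_pos hν]; simp only [Pi.add_apply]
  · right; left; funext i; rw [key i, if_pos hμ, if_neg hν]; simp only [Pi.add_apply, add_zero]
  · right; right; left; funext i; rw [key i, if_neg hμ, if_pos hν]; simp only [Pi.add_apply, add_zero]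
  · left; funext i; rw [key i, if_neg hμ, if_neg hν]; simp only [add_zero]

/-- The unit boxes of the labels of an integer box lie in its blow-up: `t ∈ [tlo, thi]`, `x ∈ box L t 1 j` ⇒ `x ∈ box L (tlo) (side) j` whenever `thi + 1 ≤ tlo + side`. [folklore] -/
theorem mem_box_of_mem_unitBox {j : ℕ} {tlo thi t x : Pt P.d} {S : ℕ} (ht : t ∈ Set.Icc tlo thi) (hS : ∀ i, thi i + 1 ≤ tlo i + S) (hx : x ∈ box P.L t 1 j) :
    x ∈ box P.L tlo S j := by
  intro i
  obtain ⟨h1, h2⟩ := hx i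
  simp only [bLo, bHi, Nat.cast_zero, sub_zero, add_zero, Nat.cast_one] at h1 h2 ⊢
  have hL : (0 : ℤ) ≤ (P.L : ℤ) ^ j := by positivity
  constructor
  · nlinarith [mul_le_mul_of_nonneg_left (ht.1 i) hL]
  · nlinarith [mul_le_mul_of_nonneg_left (ht.2 i) hL, mul_le_mul_of_nonneg_left (hS i) hL]

end Dictionary

/-! ## §2  The dichotomy at a vertex of the chart box: in `Γ_j`, or everything below in `Γ_{j−1}` -/

section Dichotomy

variable {P : Params} {m k : ℕ} (Ω : ℕ → Set (Site P 0))

/-- ★ **THE DICHOTOMY AT A VERTEX** (`j = m + 1 ≤ k`, standing range): if no fine point of the unit box of `t` projects into `Ω_{j+1}` (margin), `Ω_j` is saturated by level-`j` blocks, and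
for `m ≥ 1` every fine point of the unit box projects into `Ω_m` (collar), then EITHER the vertex `castSite t` lies in `Γ_j^{(j)}` OR every level-`m` site whose block is `castSite t` lies in
`Γ_m^{(m)}` (`Γ_m = Ω_m ∖ Ω_{m+1}` for `m ≥ 1`, `Γ₀ = Ω₁ᶜ`). [cite: Balaban1988Convergent, (2.2) p.255; Balaban1985Variational, (7) p.278, (144) p.300] -/
theorem corner_dichotomy (hmk : m + 1 ≤ k) (hm : m + 1 ≤ P.m + P.K)
    (hsat : ∀ x x' : Site P 0, iterBlockOf (m + 1) x = iterBlockOf (m + 1) x' → x ∈ Ω (m + 1) → x' ∈ Ω (m + 1))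
    {t : Pt P.d} (hfar : ∀ x ∈ box P.L t 1 (m + 1), cover P x ∉ Ω (m + 2)) (hcol : 1 ≤ m → ∀ x ∈ box P.L t 1 (m + 1), cover P x ∈ Ω m) :
    (castSite t : Site P (m + 1)) ∈ genSet Ω k (m + 1) ∨ ∀ y : Site P m, blockOf y = (castSite t : Site P (m + 1)) → y ∈ genSet Ω k m := by
  obtain ⟨xc, hxc, hce⟩ := embIter_castSite_mem_unitBox hm t
  by_cases hin : (castSite t : Site P (m + 1)) ∈ pts (m + 1) (Ω (m + 1))
  · -- the vertex is in `Ω_j^{(j)}`, and not in `Ω_{j+1}^{(j)}` by the margin: it is in `Γ_j`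
    left
    show (castSite t : Site P (m + 1)) ∈ pts (m + 1) (gammaRegion Ω k (m + 1))
    rw [mem_pts] at hin ⊢
    rcases Nat.eq_or_lt_of_le hmk with h | h
    · rw [h, gammaRegion_self]; rw [h] at hin; exact hin
    · rw [gammaRegion_mid Ω (by omega) h]
      exact ⟨hin, by rw [hce]; exact hfar xc hxc⟩
  · -- the vertex is off `Ω_j^{(j)}`: by saturation NO fine point of its block is in `Ω_j`, and every site below has its centre in the block
    right
    intro y hy
    obtain ⟨x, hx, hxe⟩ := embIter_mem_unitBox_of_blockOf_eq hm hy
    have hnot : cover P x ∉ Ω (m + 1) := by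
      intro habs
      apply hin
      rw [mem_pts, hce]
      exact hsat (cover P x) (cover P xc) (by rw [iterBlockOf_cover_of_mem_unitBox hm hx, iterBlockOf_cover_of_mem_unitBox hm hxc]) habs
    show y ∈ pts m (gammaRegion Ω k m)
    rw [mem_pts, hxe]
    rcases Nat.eq_zero_or_pos m with h0 | h0
    · subst h0
      rw [gammaRegion_zero Ω (by omega)]
      exact hnot
    · rw [gammaRegion_mid Ω h0 (by omega)]
      exact ⟨hcol h0 x hx, hnot⟩

end Dichotomy

/-! ## §3  Bond and plaquette values: `M^{m+1} U = ` print's (7) field on the chart box -/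

section Values

variable (F : T4Family) (N : ℕ) [NeZero N] (K : ℕ) {m k : ℕ} (Ω : ℕ → Set (Site (F.P K) 0)) (W : MSField (F.P K) (SU N)) (U : GaugeField (F.P K) 0 (SU N))

/-- ★★ **ON A LEVEL-`(m+1)` BOND BETWEEN TWO GOOD VERTICES, `M^{m+1} U` IS PRINT's (7) FIELD** `mixedField (Γ_{m+1}) (W_{m+1}) (W_m)`: on a bond of `Λ_{m+1}` both are `W_{m+1}` (the fibre
`AgreeOn`); off `Λ_{m+1}` both are the one-step average of a level-`m` field, and `M^m U = W_m` on the two blocks below (§2's second branch + the fibre at level `m`; two-block locality of (0.4)).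
[cite: Balaban1985Variational, (7) p.278 L26–33, (13) p.280; Balaban1988Convergent, (2.10)–(2.11) p.256; Balaban1987RG1, (0.4) p.253] -/
theorem iter_succ_eq_mixedField_of_corners (hm : m + 1 ≤ (F.P K).m + (F.P K).K) (hfib : AgreeOn (genSet Ω k) (avgFamily (avOfRecord F N K) U) W)
    (b : PBond (F.P K) (m + 1))
    (hsrc : b.src ∈ genSet Ω k (m + 1) ∨ ∀ y : Site (F.P K) m, blockOf y = b.src → y ∈ genSet Ω k m)
    (htgt : b.tgt ∈ genSet Ω k (m + 1) ∨ ∀ y : Site (F.P K) m, blockOf y = b.tgt → y ∈ genSet Ω k m) :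
    Averaging.iter (avOfRecord F N K) (m + 1) U b = Sect2.mixedField (avOfRecord F N K) (genSet Ω k (m + 1)) (W (m + 1)) (W m) b := by
  by_cases hb : b ∈ bondsOf (genSet Ω k (m + 1))
  · rw [Sect2.mixedField_of_mem _ _ _ hb]
    exact hfib (m + 1) b hb
  · rw [Sect2.mixedField_of_not_mem _ _ _ hb]
    -- both ends are OFF `Γ_{m+1}`: every site below either block is in `Γ_m`
    have hs' : ∀ y : Site (F.P K) m, blockOf y = b.src → y ∈ genSet Ω k m := by
      rcases hsrc with h | h
      · exact absurd (Or.inl h) hb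
      · exact h
    have ht' : ∀ y : Site (F.P K) m, blockOf y = b.tgt → y ∈ genSet Ω k m := by
      rcases htgt with h | h
      · exact absurd (Or.inr h) hb
      · exact h
    show (avOfRecord F N K m).avg (Averaging.iter (avOfRecord F N K) m U) b = (avOfRecord F N K m).avg (W m) b
    rw [avOfRecord_apply, blockAvg_avg]
    refine T4ReflectionConeSharp.avgFun_congr₂ _ hm _ _ b fun b' h₁ _ => hfib m b' (Or.inl ?_)
    rcases h₁ with h | h
    · exact hs' _ h
    · exact ht' _ h

/-- ★★ **THE LEVEL-`(m+1)` PLAQUETTE OF `M^{m+1} U` AT A CHART-BOX PLAQUETTE IS PRINT's (7) PLAQUETTE** `(∂V)(p′)` with `V = W_{m+1}`, `V̄ = \overline{W_m}` — all four vertices good.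
[cite: Balaban1985Variational, (7) p.278 L20–33; Balaban1988Convergent, (2.10) p.256] -/
theorem plaqHol_iter_succ_eq_mixedField (hm : m + 1 ≤ (F.P K).m + (F.P K).K) (hfib : AgreeOn (genSet Ω k) (avgFamily (avOfRecord F N K) U) W)
    (p : Plaq (F.P K) (m + 1))
    (hgood : ∀ y : Site (F.P K) (m + 1), (y = p.src ∨ y = p.src.shift p.μ ∨ y = p.src.shift p.ν ∨ y = (p.src.shift p.μ).shift p.ν) →
      (y ∈ genSet Ω k (m + 1) ∨ ∀ y' : Site (F.P K) m, blockOf y' = y → y' ∈ genSet Ω k m)) :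
    plaqHol (Averaging.iter (avOfRecord F N K) (m + 1) U) p = plaqHol (Sect2.mixedField (avOfRecord F N K) (genSet Ω k (m + 1)) (W (m + 1)) (W m)) p := by
  have hcomm : (p.src.shift p.ν).shift p.μ = (p.src.shift p.μ).shift p.ν := by
    have hne : p.μ ≠ p.ν := p.hμν.ne
    simp only [Site.shift, Function.update_of_ne hne, Function.update_of_ne hne.symm]
    exact (Function.update_comm hne _ _ _).symm
  have e1 := iter_succ_eq_mixedField_of_corners F N K Ω W U hm hfib ⟨p.src, p.μ⟩ (hgood _ (Or.inl rfl)) (hgood _ (Or.inr (Or.inl rfl)))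
  have e2 := iter_succ_eq_mixedField_of_corners F N K Ω W U hm hfib ⟨p.src.shift p.μ, p.ν⟩ (hgood _ (Or.inr (Or.inl rfl)))
    (hgood _ (Or.inr (Or.inr (Or.inr rfl))))
  have e3 := iter_succ_eq_mixedField_of_corners F N K Ω W U hm hfib ⟨p.src.shift p.ν, p.μ⟩ (hgood _ (Or.inr (Or.inr (Or.inl rfl))))
    (hgood _ (Or.inr (Or.inr (Or.inr (by show (p.src.shift p.ν).shift p.μ = _; rw [hcomm])))))
  have e4 := iter_succ_eq_mixedField_of_corners F N K Ω W U hm hfib ⟨p.src, p.ν⟩ (hgood _ (Or.inl rfl)) (hgood _ (Or.inr (Or.inr (Or.inl rfl))))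
  unfold GaugeField.plaqHol
  rw [e1, e2, e3, e4]

end Values

end Summit.QuantumFields.YangMills.BalabanUVNodes.N07ChartTopBoxPlaquetteValues

end
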